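import Summits.NavierStokesRegularity.FluidComputer.GateBudgetLatticeMember
import HarnessLib

/-!
# What no tuning can beat, part 22a: THE FIRING TEETH — the half-lattice member
# `σ_knob M = 2/(2k+1)` leaves its pulse in pure TRANSFER phase and FIRES after its clock has
# died, given the levels (the transfer freeze, the drain, the quadrature exit; the dynamics and
# the window form are part 22b `GateBudgetFiringWindow`)

Cell `pub-fluidc`, blueprint seat bp1 (gen 30); same namespace and conventions as parts 1–21
(`GateBudget*.lean`); imports part 20 (`GateBudgetLatticeMember`: the closed forms of the drift
and of the afterglow, and through it parts 5, 12, 16, 17, 19). Modes `0 = a` input, `1 = b`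
clock, `2 = c` catalyst (`u = c/ρ²`), `3 = d` transfer, `4 = ã` output; `σ_knob = ρ²/ε`.
HONEST FRAMING (verbatim): low prior, high value-of-information experiment on Tao's machine
paradigm; NOT a claim that NS blows up.

THE POINT. Parts 17–21 showed that on the LATTICE `ε = kMρ²` the total phase of the catalyst
pulse is `kπ`, the carrier leaves the pulse in pure INPUT phase and the output is capped: firing
is not robust in the knob. This part is the other half of the same mechanism, with the SAME
levels (part 19) and the SAME phase bracket (part 16): on the HALF LATTICE `2ε = (2k+1)Mρ²`
(`σ_knob M = 2/(2k+1)`, `k ≥ 0`) the total phase is `(k+½)π`, so at clock death the carrier sits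
in pure TRANSFER phase, `|a(T)| ≤ ψ + D`, `|d(T)| ≥ 1 - ψ²/2 - D` (§64 `knob_quadrature_exit`,
`knob_half_lattice_phase`). Two new laws then decide the output WITHOUT any pulse. §62 THE
TRANSFER FREEZE (`transfer_freeze`, `knob_transfer_freeze_selftimed`): `∂ₜ(d² + ã²) = 2Rcad ≥ -Rc`
(energy `a² + d² ≤ 1`), so once the clock is reversed the pair `d² + ã²` can lose at most the
rotor afterglow `R(c(T) + σ(t - T))/(μβ)` — for the knob, on the self-timed window
`[T, T + β/(2ε)]`, at most `2εu(T)/(Mβ) + e^{-M}/M` (HALF the constant of part 5's carrier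
freeze: the seed does not touch `d, ã`). §63 THE DRAIN FIRES (`knob_drain_fires`): `ã` is
non-decreasing with `∂ₜã = Kd² = K(f - ã²)`, `f = d² + ã²`; if `f ≥ m` on `[T, T']`, `ã(T) ≥ 0`
and `θ ≤ K(m - θ²)(T' - T)`, then `ã ≥ θ` from `T'` on (were `ã < θ` up to `T'`, then `d² ≥ m - θ²`
there and `ã(T') ≥ K(m - θ²)(T' - T) ≥ θ`). §65 (`knob_lattice_fire`) assembles them at the level
hypotheses of part 17's `knob_lattice_dud`; §66 (in the companion file part 22b,
`GateBudgetFiringWindow`, split off for the 400-line lint) discharges every level by part 19 as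
part 20 did (`winding_psi_le` is part 20's closed form of the phase budget for a REAL winding
number `κ₀ = ε/(Mρ²) ≤ κ`): `knob_lattice_member_fires` — under `16 ≤ K`, `48 log K ≤ M ≤ K¹⁰`,
`ε² ≤ 1/(6K²⁰)`, `2ε = (2k+1)Mρ²` and `Δ < 1/16`, with `ψ`, `D` above the closed forms,
`ψ²/2 + D ≤ 1` and `θ ≤ (K/8)((1 - ψ²/2 - D)² - A′ - θ²)`, `A′ = 8(K⁻¹⁰ + 4e^{-M}/M)/M + e^{-M}/M`,
the member FIRES: `ã(t) ≥ θ` for all `t ≥ T + 1/8`, `T` its own dousing time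
(`1 ≤ s₀ ≤ 3/2 < T ≤ s₀ + Δ`). `exists_half_lattice_knob`: every window `[ρhi²/2, ρhi²]` with
`3Mρhi² ≤ 4ε` holds a half-lattice knob with `k + ½ ≤ 2ε/(Mρhi²)`; `knob_window_member_fires`:
EVERY DYADIC KNOB WINDOW WITH `σ_knob M ≤ 4/3` CONTAINS A MEMBER THAT FIRES AFTER ITS CLOCK HAS
DIED. With part 20: every such window contains a dud AND a firing member — neither outcome is
robust in the knob at scale `σ_knob M ~ 1`; the response in `σ_knob` is a comb of pitch `~1/M`.

HONEST LIMITS. (i) As in part 20 the statements are informative only for `ψ²/2 + D` small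
(`κ ≲ M/10`, `K²Δ² ≲ 1`): `hψ`, `hD`, `hm`, `hfire` stay explicit hypotheses, NOT discharged here
(at `M = K¹⁰` they hold with `θ = 3/4` on every window with `200ε/K²⁰ ≤ ρhi² ≤ 4ε/(3K¹⁰)`;
that routine check is not performed in this file). (ii) Windows with winding number
`2ε/(Mρhi²) ∈ (1, 3/2)` contain NO half-lattice point: the hypothesis `3Mρhi² ≤ 4ε` is needed,
part 20's duds only need `Mρhi² ≤ 2ε`. (iii) Member-specific times: the dud of part 20 and the
tooth of this part have each ITS OWN `T`; no common-time statement is made, and a second pulse of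
the DUD after `T + 1/8` is still not excluded (the tooth has fired for good: `ã` is monotone).
(iv) Nothing is claimed about members off the two lattices, or about Navier–Stokes.
[cite: Tao2016AveragedNS, §5.5 Theorem 5.3, (5.5), (5.6), (b-eq), (c-eq), (tcable)]
-/

noncomputable section

namespace Summit.NavierStokesRegularity.FluidComputer.GateBudget

open Real Set Filter Topology
open Literature.Analysis.FluidPDE.Tao2016AveragedNS
open Literature.Analysis.FluidPDE.Tao2016AveragedNS.Thm53 (monotoneOn_sub_of_le_deriv)

/-! ## §62 The transfer freeze: after clock death the pair `d² + ã²` keeps its level -/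

/-- **TRANSFER FREEZE.** Along `fiveGateCircuit ε σ μ R K` from (5.6) (`σ, R ≥ 0`, `μ > 0`): if the
clock is reversed, `b ≤ -β` on `[T, T']` (`β > 0`, `T ≥ 0`), then for `t ∈ [T, T']`
`d(t)² + ã(t)² ≥ d(T)² + ã(T)² - R(c(T) + σ(t - T))/(μβ)`: by (dora) `∂ₜ(d² + ã²) = 2Rcad ≥ -Rc`
(`2|ad| ≤ a² + d² ≤ 1`), and `c ≤ c(T)e^{-μβ(t-T)} + σ/(μβ)` (`pulse_decay`) integrates to the rotor
AFTERGLOW `Rc(T)/(μβ)` plus the seed leak — half of part 5's `carrier_freeze` constant, since the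
seed never touches the output pair. [cite: Tao2016AveragedNS, §5.5 (5.5), (b-eq), (est)] -/
theorem transfer_freeze {ε σ μ R K : ℝ} {X : ℝ → Fin 5 → ℝ}
    (hX : ∀ t, HasDerivAt X (fiveGateCircuit ε σ μ R K (X t)) t) (h0 : X 0 = delayInit)
    (hσ : 0 ≤ σ) (hμ : 0 < μ) (hR : 0 ≤ R) {T T' β : ℝ} (hT : 0 ≤ T) (hβ : 0 < β)
    (hb : ∀ t ∈ Icc T T', X t 1 ≤ -β) {t : ℝ} (ht : t ∈ Icc T T') :
    X T 3 ^ 2 + X T 4 ^ 2 - R * (X T 2 + σ * (t - T)) / (μ * β) ≤ X t 3 ^ 2 + X t 4 ^ 2 := by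
  have hk : 0 < μ * β := mul_pos hμ hβ
  have hcT : 0 ≤ X T 2 := c_nonneg hX h0 hσ hT
  -- the majorant of `c` from `pulse_decay` and its primitive, as in part 5
  have hmono := monotoneOn_sub_of_le_deriv (f := fun r => X r 3 ^ 2 + X r 4 ^ 2)
    (f' := fun r => 2 * R * X r 2 * X r 0 * X r 3)
    (φ := fun r => -(R * (X T 2 * exp (-(μ * β * (r - T))) + σ / (μ * β))))
    (Φ := fun r => R * (X T 2 / (μ * β) * exp (-(μ * β * (r - T))) - σ / (μ * β) * r))
    (convex_Icc T T') (fun r _ => out_energy (hX r))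
    (fun r _ => by
      have e1 : HasDerivAt (fun x => exp (-(μ * β * (x - T))))
          (exp (-(μ * β * (r - T))) * -(μ * β * 1)) r :=
        (((hasDerivAt_id' r).sub_const T).const_mul (μ * β)).neg.exp
      refine (((e1.const_mul (X T 2 / (μ * β))).sub
        ((hasDerivAt_id' r).const_mul (σ / (μ * β)))).const_mul R).congr_deriv ?_
      field_simp
      ring)
    (fun r hr => by
      have hcr : 0 ≤ X r 2 := c_nonneg hX h0 hσ (hT.trans hr.1)
      have hdec := pulse_decay hX h0 hσ hμ hT hβ hb hr
      -- energy: `a² + d² ≤ 1`, so `2ad ≥ -1` and `2Rcad ≥ -Rc`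
      have hE : X r 0 ^ 2 + X r 1 ^ 2 + X r 2 ^ 2 + X r 3 ^ 2 + X r 4 ^ 2 = 1 := by
        simpa [energy, Fin.sum_univ_five] using energy_init hX h0 r
      have had : -1 ≤ 2 * (X r 0 * X r 3) := by
        nlinarith [sq_nonneg (X r 0 + X r 3), sq_nonneg (X r 1), sq_nonneg (X r 2),
          sq_nonneg (X r 4)]
      have h1 := mul_le_mul_of_nonneg_left had (mul_nonneg hR hcr)
      have h2 := mul_le_mul_of_nonneg_left hdec hR
      show -(R * (X T 2 * exp (-(μ * β * (r - T))) + σ / (μ * β)))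
          ≤ 2 * R * X r 2 * X r 0 * X r 3
      linarith)
  have h := hmono (left_mem_Icc.2 (ht.1.trans ht.2)) ht ht.1
  dsimp only at h
  simp only [sub_self, mul_zero, neg_zero, exp_zero, mul_one] at h
  -- h : f(T) - Φ(T) ≤ f(t) - Φ(t); now Φ(t) - Φ(T) ≥ -R(c(T) + σ(t-T))/(μβ)
  have hq : 0 ≤ X T 2 / (μ * β) := div_nonneg hcT hk.le
  have h3 : 0 ≤ R * (X T 2 / (μ * β) * exp (-(μ * β * (t - T)))) := by positivity
  have hsplit : R * (X T 2 + σ * (t - T)) / (μ * β)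
      = R * (X T 2 / (μ * β)) + R * (σ / (μ * β)) * (t - T) := by
    field_simp
  rw [hsplit]
  linarith [h, h3]

variable {K M ε ρ : ℝ} {X : ℝ → Fin 5 → ℝ} {C : ℝ → ℝ}

/-- **TRANSFER FREEZE, SELF-TIMED (knob units).** Along `rotorCircuit K M ε ρ` from (5.6)
(`0 < ε`, `0 < ρ`, `0 < M`): if `b(T) ≤ -β < 0` at some `T ≥ 0`, then on the window
`[T, T + β/(2ε)]` — where the clock stays `≤ -β/2` (`clock_stays_reversed`) —
`d(t)² + ã(t)² ≥ d(T)² + ã(T)² - (2εu(T)/(Mβ) + e^{-M}/M)`, `u = c/ρ²`: `transfer_freeze` with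
`R = ρ⁻²`, `σ = ρ²e^{-M}`, `μ = M/ε`, the seed leak `2εe^{-M}(t - T)/(Mβ) ≤ e^{-M}/M`.
[cite: Tao2016AveragedNS, §5.5 Theorem 5.3, (5.5), (b-eq), (tcable)] -/
theorem knob_transfer_freeze_selftimed
    (hX : ∀ t, HasDerivAt X (RotorKnob.rotorCircuit K M ε ρ (X t)) t) (h0 : X 0 = delayInit)
    (hε : 0 < ε) (hρ : 0 < ρ) (hM : 0 < M) {T β : ℝ} (hT : 0 ≤ T) (hβ : 0 < β)
    (hbT : X T 1 ≤ -β) {t : ℝ} (ht : t ∈ Icc T (T + β / (2 * ε))) :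
    X T 3 ^ 2 + X T 4 ^ 2 - (2 * ε * (X T 2 / ρ ^ 2) / (M * β) + exp (-M) / M)
      ≤ X t 3 ^ 2 + X t 4 ^ 2 := by
  have hXf := hX
  rw [RotorKnob.rotorCircuit_eq_fiveGate] at hXf
  have hμ : 0 < ε⁻¹ * M := by positivity
  have hσ : 0 ≤ ρ ^ 2 * exp (-M) := by positivity
  have hR : 0 ≤ (ρ ^ 2)⁻¹ := by positivity
  have hb : ∀ r ∈ Icc T (T + β / (2 * ε)), X r 1 ≤ -(β / 2) := fun r hr =>
    clock_stays_reversed hXf h0 hε hμ.le hbT hr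
  have key := transfer_freeze hXf h0 hσ hμ hR hT (half_pos hβ) hb ht
  -- the loss in knob units: `2ε(u(T) + e^{-M}(t - T))/(Mβ)`, and `t - T ≤ β/(2ε)`
  have h1 : (ρ ^ 2)⁻¹ * (X T 2 + ρ ^ 2 * exp (-M) * (t - T)) / (ε⁻¹ * M * (β / 2))
      = 2 * ε * (X T 2 / ρ ^ 2) / (M * β) + 2 * ε * exp (-M) * (t - T) / (M * β) := by
    field_simp
  have htT : t - T ≤ β / (2 * ε) := by linarith [ht.2]
  have h2 : 2 * ε * exp (-M) * (t - T) / (M * β) ≤ exp (-M) / M := by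
    rw [div_le_div_iff₀ (by positivity) hM]
    have h3 : 2 * ε * exp (-M) * (t - T) ≤ 2 * ε * exp (-M) * (β / (2 * ε)) :=
      mul_le_mul_of_nonneg_left htT (by positivity)
    have h4 : 2 * ε * exp (-M) * (β / (2 * ε)) = exp (-M) * β := by
      field_simp
    rw [h4] at h3
    nlinarith [h3, hM.le, (exp_pos (-M)).le, hβ.le]
  rw [h1] at key
  linarith [key, h2]

/-! ## §63 The drain fires: a frozen output pair is converted into output -/

/-- **THE DRAIN FIRES.** Along `rotorCircuit K M ε ρ` from (5.6) (`K ≥ 0`) the output `ã` is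
non-decreasing with `∂ₜã = Kd²`. If on `[T, T']` the output pair stays above a level,
`d² + ã² ≥ m`, if `ã(T) ≥ 0`, and if `θ ≥ 0` satisfies `θ ≤ K(m - θ²)(T' - T)`, then `ã(t) ≥ θ`
for every `t ≥ T'`: were `ã(T') < θ`, then `0 ≤ ã < θ` on `[T, T']`, hence `d² ≥ m - θ²` there
and `ã(T') ≥ ã(T) + K(m - θ²)(T' - T) ≥ θ`. (The Riccati comparison `ã ≥ √m·tanh(K√m(t-T))` is
sharper; the linear form is what the comb needs.) [cite: Tao2016AveragedNS, §5.5 (5.5), (ta-eq)] -/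
theorem knob_drain_fires (hX : ∀ t, HasDerivAt X (RotorKnob.rotorCircuit K M ε ρ (X t)) t)
    (hK : 0 ≤ K) {T T' m θ : ℝ} (hTT' : T ≤ T') (he : 0 ≤ X T 4) (hθ : 0 ≤ θ)
    (hm : ∀ t ∈ Icc T T', m ≤ X t 3 ^ 2 + X t 4 ^ 2)
    (hfire : θ ≤ K * (m - θ ^ 2) * (T' - T)) : ∀ t, T' ≤ t → θ ≤ X t 4 := by
  have hmon := RotorKnob.rotorCircuit_output_monotone hK hX
  suffices hT' : θ ≤ X T' 4 from fun t ht => hT'.trans (hmon ht)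
  refine not_lt.1 fun hlt => ?_
  -- while `ã < θ` on `[T, T']`: `d² = f - ã² ≥ m - θ²`, so `ã` climbs at rate `≥ K(m - θ²)`
  have hmono := monotoneOn_sub_of_le_deriv (f := fun s => X s 4) (f' := fun s => K * X s 3 ^ 2)
    (φ := fun _ => K * (m - θ ^ 2)) (Φ := fun s => K * (m - θ ^ 2) * s) (convex_Icc T T')
    (fun s _ => RotorKnob.hasDerivAt_e hX s)
    (fun s _ => by simpa using (hasDerivAt_id' s).const_mul (K * (m - θ ^ 2)))
    (fun s hs => by
      have h1 : X s 4 ≤ X T' 4 := hmon hs.2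
      have h2 : X T 4 ≤ X s 4 := hmon hs.1
      have h3 : X s 4 ^ 2 ≤ θ ^ 2 := by nlinarith
      have h4 : m - θ ^ 2 ≤ X s 3 ^ 2 := by linarith [hm s hs]
      show K * (m - θ ^ 2) ≤ K * X s 3 ^ 2
      exact mul_le_mul_of_nonneg_left h4 hK)
  have h := hmono (left_mem_Icc.2 hTT') (right_mem_Icc.2 hTT') hTT'
  dsimp only at h
  have h5 : K * (m - θ ^ 2) * (T' - T) ≤ X T' 4 - X T 4 := by linarith
  linarith

/-! ## §64 The quadrature exit: total phase `(k+½)π` leaves the carrier in pure transfer phase -/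

/-- **QUADRATURE EXIT.** If the total phase is within `ψ` of a HALF-INTEGER multiple of `π`,
`|Θ - (k+½)π| ≤ ψ`, then `|a(T)| ≤ ψ + D` and `1 - ψ²/2 - D ≤ |d(T)|`, `D` the drift of part 16's
`knob_total_tracking`: the carrier leaves in (nearly) PURE TRANSFER PHASE
(`sin(x + π/2 + kπ) = ±cos x`, `cos(x + π/2 + kπ) = ∓sin x`, `|sin x| ≤ |x|`, `cos x ≥ 1 - x²/2`)
— the mirror image of part 16's `knob_pinned_exit`.
[cite: Tao2016AveragedNS, §5.5 Theorem 5.3, (5.5)] -/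
theorem knob_quadrature_exit (hX : ∀ t, HasDerivAt X (RotorKnob.rotorCircuit K M ε ρ (X t)) t)
    (h0 : X 0 = delayInit) (hC : ∀ t, HasDerivAt C (X t 2) t) (hε : 0 ≤ ε) (hK : 0 ≤ K)
    {s₀ T : ℝ} (hs₀ : 0 ≤ s₀) (hsT : s₀ ≤ T) (k : ℕ) {ψ : ℝ}
    (hψ : |(C T - C 0) / ρ ^ 2 - (k + 1 / 2) * π| ≤ ψ) :
    |X T 0| ≤ ψ + (4 * ((ε + ρ ^ 2 * exp (-M) + K * X s₀ 4) * s₀)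
        + 2 * ((ε + ρ ^ 2 * exp (-M) + K * X T 4) * (T - s₀))) ∧
      1 - ψ ^ 2 / 2 - (4 * ((ε + ρ ^ 2 * exp (-M) + K * X s₀ 4) * s₀)
        + 2 * ((ε + ρ ^ 2 * exp (-M) + K * X T 4) * (T - s₀))) ≤ |X T 3| := by
  obtain ⟨td, ta⟩ := knob_total_tracking hX h0 hC hε hK hs₀ hsT
  set θ := (C T - C 0) / ρ ^ 2 - (k + 1 / 2) * π with hθ
  have hΘ : (C T - C 0) / ρ ^ 2 = θ + π / 2 + k * π := by rw [hθ]; ring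
  rw [hΘ, sin_add_nat_mul_pi, sin_add_pi_div_two] at td
  rw [hΘ, cos_add_nat_mul_pi, cos_add_pi_div_two] at ta
  have hu : |((-1 : ℝ) ^ k)| = 1 := by rw [abs_pow, abs_neg, abs_one, one_pow]
  have hsin : |(-1 : ℝ) ^ k * -sin θ| ≤ ψ := by
    rw [abs_mul, hu, one_mul, abs_neg]; exact abs_sin_le_abs.trans hψ
  have hθ2 : θ ^ 2 ≤ ψ ^ 2 := by
    nlinarith [abs_nonneg θ, hψ, sq_abs θ]
  have hcos : 1 - ψ ^ 2 / 2 ≤ |(-1 : ℝ) ^ k * cos θ| := by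
    rw [abs_mul, hu, one_mul]
    exact le_trans (by linarith [one_sub_sq_div_two_le_cos (x := θ)]) (le_abs_self (cos θ))
  constructor
  · have h := abs_sub_abs_le_abs_sub (X T 0) ((-1 : ℝ) ^ k * -sin θ)
    linarith
  · have h := abs_sub_abs_le_abs_sub ((-1 : ℝ) ^ k * cos θ) (X T 3)
    rw [abs_sub_comm] at h
    linarith

/-- **THE HALF-LATTICE PHASE.** On the half-lattice member `2ε = (2k+1)Mρ²`
(`σ_knob M = 2/(2k+1)`, winding number `ε/(Mρ²) = k + ½`), with the window of part 16's
`knob_phase_bracket`, swing `≥ π - η` and pre-entry dose `|Φ₀| ≤ φ₀`: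
`|Θ - (k+½)π| ≤ (k+½)(η + (πε²/(Mϱ²) + D₀)/(1 - ε²/(Mϱ²))) + φ₀` — the total phase at clock death
is `k + ½` half turns up to the level losses (part 16's `knob_lattice_phase`, verbatim, at a
half-integer winding number). [cite: Tao2016AveragedNS, §5.5 Theorem 5.3, (5.5), (b-eq)] -/
theorem knob_half_lattice_phase
    (hX : ∀ t, HasDerivAt X (RotorKnob.rotorCircuit K M ε ρ (X t)) t)
    (h0 : X 0 = delayInit) (hε : 0 < ε) (hρ : 0 < ρ) (hM : 0 < M)
    (hC : ∀ t, HasDerivAt C (X t 2) t) (k : ℕ) (hk : 2 * ε = (2 * k + 1) * M * ρ ^ 2)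
    {s₀ T ϱ η φ₀ : ℝ} (hsT : s₀ ≤ T) (hϱ : 0 < ϱ) (hq : ε ^ 2 < M * ϱ ^ 2)
    (hc : ∀ t ∈ Icc s₀ T, 0 < X t 2) (hr : ∀ t ∈ Icc s₀ T, ϱ ^ 2 ≤ X t 1 ^ 2 + X t 2 ^ 2)
    (hη : π - η ≤ arctan (X s₀ 1 / X s₀ 2) - arctan (X T 1 / X T 2))
    (hΦ₀ : |(C s₀ - C 0) / ρ ^ 2| ≤ φ₀) :
    |(C T - C 0) / ρ ^ 2 - (k + 1 / 2) * π| ≤ (k + 1 / 2) * (η + (π * (ε ^ 2 / (M * ϱ ^ 2))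
        + ρ ^ 2 * exp (-M) * (T - s₀) / ϱ) / (1 - ε ^ 2 / (M * ϱ ^ 2))) + φ₀ := by
  obtain ⟨hlo, hhi⟩ := knob_phase_bracket hX h0 hε hρ hM hC hsT hϱ hq hc hr hη
  have hκ : ε / (M * ρ ^ 2) = k + 1 / 2 := by
    rw [div_eq_iff (by positivity)]; linarith
  rw [hκ] at hlo hhi
  have h1q : 0 < 1 - ε ^ 2 / (M * ϱ ^ 2) := sub_pos.2 ((div_lt_one (by positivity)).2 hq)
  have hq0 : 0 ≤ ε ^ 2 / (M * ϱ ^ 2) := by positivity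
  have hD0 : 0 ≤ ρ ^ 2 * exp (-M) * (T - s₀) / ϱ := by
    have : 0 ≤ T - s₀ := by linarith
    positivity
  have hk0 : (0 : ℝ) ≤ k + 1 / 2 := by positivity
  -- the excess `(πq + D₀)/(1 - q)` dominates `D₀`
  have hex : ρ ^ 2 * exp (-M) * (T - s₀) / ϱ ≤ (π * (ε ^ 2 / (M * ϱ ^ 2))
      + ρ ^ 2 * exp (-M) * (T - s₀) / ϱ) / (1 - ε ^ 2 / (M * ϱ ^ 2)) := by
    rw [le_div_iff₀ h1q]
    nlinarith [mul_nonneg hD0 hq0, mul_nonneg pi_pos.le hq0]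
  have hup : (π + ρ ^ 2 * exp (-M) * (T - s₀) / ϱ) / (1 - ε ^ 2 / (M * ϱ ^ 2))
      = π + (π * (ε ^ 2 / (M * ϱ ^ 2)) + ρ ^ 2 * exp (-M) * (T - s₀) / ϱ)
        / (1 - ε ^ 2 / (M * ϱ ^ 2)) := by
    have hne : M * ϱ ^ 2 - ε ^ 2 ≠ 0 := (sub_pos.2 hq).ne'
    field_simp
    ring
  have hη0 : 0 < η := by linarith [swing_lt_pi (X s₀ 1 / X s₀ 2) (X T 1 / X T 2)]
  have hΦ₀' := abs_le.1 hΦ₀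
  have hsplit : (C T - C 0) / ρ ^ 2 - (k + 1 / 2) * π
      = ((C T - C s₀) / ρ ^ 2 - (k + 1 / 2) * π) + (C s₀ - C 0) / ρ ^ 2 := by ring
  rw [hsplit]
  refine abs_le.2 ⟨?_, ?_⟩
  · have h := mul_le_mul_of_nonneg_left hex hk0
    nlinarith [hlo, hΦ₀'.1, h, mul_nonneg hk0 hD0]
  · rw [mul_div_assoc, hup] at hhi
    nlinarith [hhi, hΦ₀'.2, mul_nonneg hk0 hη0.le]

/-! ## §65 The half-lattice member fires, given the levels -/

/-- **THE HALF-LATTICE MEMBER FIRES (given the levels).** Along `rotorCircuit K M ε ρ` from (5.6)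
on the HALF LATTICE `2ε = (2k+1)Mρ²`, with a catalyst primitive `C`, suppose at times
`0 ≤ s₀ ≤ T`: armed entry `b(s₀) ≥ b₁ > 0`, `c(s₀) ≤ γ₁`, pre-entry dose `|Φ₀| ≤ φ₀`; catalyst
alive and clock radius `≥ ϱ` on `[s₀, T]` (`Mϱ² > ε²`); dead exit `b(T) ≤ -β < 0`, `c(T) ≤ λ₀ρ²`
— the hypotheses of part 17's `knob_lattice_dud`. If `ψ ≥ (k+½)ζ + φ₀` (`ζ` the phase loss of
part 16) and `D ≥` the drift, with `ψ²/2 + D ≤ 1`, then (a) `|a(T)| ≤ ψ + D`,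
`|d(T)| ≥ 1 - ψ²/2 - D` (TRANSFER-PHASE EXIT), and (b) for every `θ ≥ 0` with
`θ ≤ K((1 - ψ²/2 - D)² - A′ - θ²)·β/(2ε)`, `A′ = 2ελ₀/(Mβ) + e^{-M}/M` (the transfer afterglow),
the output satisfies `ã(t) ≥ θ` for all `t ≥ T + β/(2ε)`: §62 freezes `d² + ã² ≥ (1-ψ²/2-D)² - A′`
on the self-timed window and §63 fires the drain on it. THE MIRROR IMAGE OF THE DUD.
[cite: Tao2016AveragedNS, §5.5 Theorem 5.3, (5.5), (5.6), (b-eq), (c-eq), (tcable)] -/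
theorem knob_lattice_fire (hX : ∀ t, HasDerivAt X (RotorKnob.rotorCircuit K M ε ρ (X t)) t)
    (h0 : X 0 = delayInit) (hε : 0 < ε) (hρ : 0 < ρ) (hM : 0 < M) (hK : 0 ≤ K)
    (hC : ∀ t, HasDerivAt C (X t 2) t) (k : ℕ) (hk : 2 * ε = (2 * k + 1) * M * ρ ^ 2)
    {s₀ T ϱ β b₁ γ₁ lam₀ φ₀ ψ D θ : ℝ} (hs₀ : 0 ≤ s₀) (hsT : s₀ ≤ T)
    (hϱ : 0 < ϱ) (hq : ε ^ 2 < M * ϱ ^ 2) (hc : ∀ t ∈ Icc s₀ T, 0 < X t 2)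
    (hr : ∀ t ∈ Icc s₀ T, ϱ ^ 2 ≤ X t 1 ^ 2 + X t 2 ^ 2) (hb₁ : 0 < b₁) (hbs : b₁ ≤ X s₀ 1)
    (hcγ : X s₀ 2 ≤ γ₁) (hβ : 0 < β) (hbT : X T 1 ≤ -β) (hcl : X T 2 ≤ lam₀ * ρ ^ 2)
    (hΦ₀ : |(C s₀ - C 0) / ρ ^ 2| ≤ φ₀)
    (hψ : (k + 1 / 2) * (arctan (γ₁ / b₁) + arctan (lam₀ * ρ ^ 2 / β)
      + (π * (ε ^ 2 / (M * ϱ ^ 2)) + ρ ^ 2 * exp (-M) * (T - s₀) / ϱ)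
        / (1 - ε ^ 2 / (M * ϱ ^ 2))) + φ₀ ≤ ψ)
    (hD : 4 * ((ε + ρ ^ 2 * exp (-M) + K * X s₀ 4) * s₀)
      + 2 * ((ε + ρ ^ 2 * exp (-M) + K * X T 4) * (T - s₀)) ≤ D) (hm : 0 ≤ 1 - ψ ^ 2 / 2 - D)
    (hθ : 0 ≤ θ)
    (hfire : θ ≤ K * ((1 - ψ ^ 2 / 2 - D) ^ 2 - (2 * ε * lam₀ / (M * β) + exp (-M) / M)
      - θ ^ 2) * (β / (2 * ε))) :
    |X T 0| ≤ ψ + D ∧ 1 - ψ ^ 2 / 2 - D ≤ |X T 3| ∧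
      ∀ t, T + β / (2 * ε) ≤ t → θ ≤ X t 4 := by
  have hη := knob_swing_lower hb₁ hbs (hc s₀ ⟨le_rfl, hsT⟩) hcγ hβ hbT (hc T ⟨hsT, le_rfl⟩) hcl
  have hph := knob_half_lattice_phase hX h0 hε hρ hM hC k hk hsT hϱ hq hc hr hη hΦ₀
  obtain ⟨ha, hd⟩ := knob_quadrature_exit hX h0 hC hε.le hK hs₀ hsT k (hph.trans hψ)
  have ha' : |X T 0| ≤ ψ + D := by linarith
  have hd' : 1 - ψ ^ 2 / 2 - D ≤ |X T 3| := le_trans (by linarith) hd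
  refine ⟨ha', hd', ?_⟩
  -- at clock death the output pair holds at least `d(T)² ≥ (1 - ψ²/2 - D)²`
  have hsqd : (1 - ψ ^ 2 / 2 - D) ^ 2 ≤ X T 3 ^ 2 := by
    rw [← sq_abs (X T 3)]
    exact pow_le_pow_left₀ hm hd' 2
  have hT0 : 0 ≤ T := hs₀.trans hsT
  have hu : X T 2 / ρ ^ 2 ≤ lam₀ := by rwa [div_le_iff₀ (by positivity)]
  have hMβ : 0 < M * β := by positivity
  have hA : 2 * ε * (X T 2 / ρ ^ 2) / (M * β) ≤ 2 * ε * lam₀ / (M * β) :=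
    div_le_div_of_nonneg_right (mul_le_mul_of_nonneg_left hu (by positivity)) hMβ.le
  -- §62: the pair is frozen above `(1 - ψ²/2 - D)² - A′` on the self-timed window
  have hfz : ∀ t ∈ Icc T (T + β / (2 * ε)),
      (1 - ψ ^ 2 / 2 - D) ^ 2 - (2 * ε * lam₀ / (M * β) + exp (-M) / M)
        ≤ X t 3 ^ 2 + X t 4 ^ 2 := fun t ht => by
    have h := knob_transfer_freeze_selftimed hX h0 hε hρ hM hT0 hβ hbT ht
    nlinarith [sq_nonneg (X T 4)]
  -- §63: the drain fires on it
  have hw0 : 0 ≤ β / (2 * ε) := by positivity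
  have hwin : T ≤ T + β / (2 * ε) := by linarith
  have hfire' : θ ≤ K * ((1 - ψ ^ 2 / 2 - D) ^ 2 - (2 * ε * lam₀ / (M * β) + exp (-M) / M)
      - θ ^ 2) * (T + β / (2 * ε) - T) := by
    have : T + β / (2 * ε) - T = β / (2 * ε) := by ring
    rw [this]; exact hfire
  exact knob_drain_fires hX hK hwin (RotorKnob.e_nonneg hX h0 hK hT0) hθ hfz hfire'

end Summit.NavierStokesRegularity.FluidComputer.GateBudget
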